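import Mathlib
import Summits.Ventures.PercRepro2.Defs
import Summits.Ventures.PercRepro2.Graph
import Summits.Ventures.PercRepro2.Events
import Summits.Ventures.PercRepro2.R21PinInduction
import Summits.Ventures.PercRepro2.R21BernAll
import Summits.Ventures.PercRepro2.XWForm
import Summits.Ventures.PercRepro2.XWLeaf

/-!
# The `(s, u) ↔ (y, o)` symmetry of the cross W-form, the second pendant identity, and the exact
(CQH) identity (PercRepro2, p2)

`XW(p)` is symmetric under exchanging the pair `(s, u)` with `(y, o)` (`xwBil_swap`): the three
events `a = {s ↔ u}`, `λ = {y ↔ o}`, `S = {s ↔ y}` are permuted into `λ, a, S`.  Hence the pendant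
identity of `XWLeaf.lean` transfers: if `u` is a leaf hanging off `s` by a single edge, `XW(p) = 0`
(`xwBil_leaf_u_eq_zero`).  `cqh_slack_eq` states the exact identity `R − Cov(a, Q ∧ h) = XW + [P(Q)P(Qah) − P(Qa)P(Qh)]`
behind `cqh_of_xw` as an equation.  Record P2-G22-WFORM.md §1, §6 (the two tight families).
-/

namespace Summit.Ventures.PercRepro2

section Swap

variable {V : Type*} {E : Type*} [Fintype E] [DecidableEq E] {R : Type*} [CommRing R]

/-- **The `(s, u) ↔ (y, o)` symmetry** of the diagonal of the cross W-form. -/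
lemma xwBil_swap (ends : E → Sym2 V) (s y o u : V) (p : E → R) :
    xwBil ends y s u o p p = xwBil ends s y o u p p := by
  unfold xwBil
  rw [connEvent_comm ends y s, Set.inter_comm (connEvent ends y o) (connEvent ends s u),
    Set.inter_comm (connEvent ends s y ∩ connEvent ends y o) (connEvent ends s u)]
  have e1 : connEvent ends s u ∩ (connEvent ends s y ∩ connEvent ends y o) =
      connEvent ends s y ∩ connEvent ends s u ∩ connEvent ends y o := by
    rw [← Set.inter_assoc, Set.inter_comm (connEvent ends s u) (connEvent ends s y)]
  rw [e1]
  ring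

end Swap

section LeafU

variable {V : Type*} {E : Type*} [Fintype E] [DecidableEq E] {R : Type*} [CommRing R]

/-- **(XW) is an identity when `u` hangs off `s` by a single edge**: if `u` is a leaf whose unique
edge `e` goes to `s ≠ u`, and `y, o ≠ u`, then `XW(p) = 0`. -/
theorem xwBil_leaf_u_eq_zero (p : E → R) (ends : E → Sym2 V) {e : E} {s y o u : V}
    (hleaf : ∀ e', u ∈ ends e' → e' = e) (hends : ends e = s(s, u)) (hsu : s ≠ u) (hyu : y ≠ u)
    (hou : o ≠ u) : xwBil ends s y o u p p = 0 := by
  rw [← xwBil_swap]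
  exact xwBil_leaf_eq_zero p ends hleaf hends hsu hyu hou

end LeafU

section Identity

variable {V : Type*} {E : Type*} [Fintype E] [DecidableEq E] {R : Type*} [CommRing R]

/-- **The exact identity behind `cqh_of_xw`**: the (CQH) slack `R − Cov(a, Q ∧ h)` equals
`XW(p) + [P(Q)·P(Q a h) − P(Q a)·P(Q h)]` (the bracket is the BHK same-cluster term). -/
theorem cqh_slack_eq (p : E → R) (ends : E → Sym2 V) (s y o u : V) :
    r21Bil ends s y o u p p -
        (prob p (connEvent ends s u ∩ clusterInEvent ends s {W : Set V | o ∈ W} ∩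
            (connEvent ends s y)ᶜ) -
          prob p (connEvent ends s u) *
            prob p (clusterInEvent ends s {W : Set V | o ∈ W} ∩ (connEvent ends s y)ᶜ)) =
      xwBil ends s y o u p p +
        (prob p (connEvent ends s y)ᶜ *
            prob p (connEvent ends s u ∩ clusterInEvent ends s {W : Set V | o ∈ W} ∩
              (connEvent ends s y)ᶜ) -
          prob p (connEvent ends s u ∩ (connEvent ends s y)ᶜ) *
            prob p (clusterInEvent ends s {W : Set V | o ∈ W} ∩ (connEvent ends s y)ᶜ)) := by
  classical
  unfold r21Bil xwBil
  rw [clusterInEvent_mem_eq_connEvent_ycl ends s o]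
  set S := connEvent ends s y with hS
  set a := connEvent ends s u with ha
  set h := connEvent ends s o with hh
  set l := connEvent ends y o with hl
  have e1 : S ∩ a ∩ h = S ∩ a ∩ l := by
    rw [Set.inter_right_comm, connEvent_sy_inter_so_xw, Set.inter_right_comm]
  have e2 : S ∩ h = S ∩ l := connEvent_sy_inter_so_xw ends s y o
  have hPa : prob p a = prob p (S ∩ a) + prob p (a ∩ Sᶜ) := by
    rw [← prob_inter_add_prob_inter_compl p a S, Set.inter_comm a S]
  have hPl : prob p l = prob p (S ∩ l) + prob p (l ∩ Sᶜ) := by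
    rw [← prob_inter_add_prob_inter_compl p l S, Set.inter_comm l S]
  have hPh : prob p h = prob p (S ∩ l) + prob p (h ∩ Sᶜ) := by
    rw [← prob_inter_add_prob_inter_compl p h S, Set.inter_comm h S, e2]
  have hPal : prob p (a ∩ l) = prob p (S ∩ a ∩ l) + prob p (a ∩ l ∩ Sᶜ) := by
    rw [← prob_inter_add_prob_inter_compl p (a ∩ l) S, Set.inter_comm (a ∩ l) S, ← Set.inter_assoc]
  have hPah : prob p (a ∩ h) = prob p (S ∩ a ∩ l) + prob p (a ∩ h ∩ Sᶜ) := by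
    rw [← prob_inter_add_prob_inter_compl p (a ∩ h) S, Set.inter_comm (a ∩ h) S,
      ← Set.inter_assoc, e1]
  have hPS : prob p S = 1 - prob p Sᶜ := by rw [prob_compl, sub_sub_cancel]
  rw [hPa, hPh, hPah, hPal, hPl, hPS]
  ring

end Identity

end Summit.Ventures.PercRepro2
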